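import Summits.Ventures.LatticeQCDFlow.Exactness.IMHCommonRandomNumbersMeetingTimeSharp
import HarnessLib

/-!
# Exponential moments of the meeting time of two coupled flow-MCMC runs: `E[s^{T_M}] = 1 + (s − 1)·Σ_{n<M} sⁿ·P(X_n ≠ X′_n)
# ≤ 1 + (s − 1)·P(X_0 ≠ X′_0)/(1 − s(1 − A))` for `1 ≤ s < 1/(1 − A)`, uniformly in `M` — all exponential moments below the rate `log(1/(1 − A))`

HONEST FRAMING: exact (Metropolis-corrected) sampling algorithms for lattice gauge theory;
figures of merit are autocorrelation/cost numbers at stated couplings and volumes; no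
continuum-physics claim.

Venture `LatticeQCDFlow` (cell pub-lqcd), topic `Exactness`; FANOUT row 30 (lean-1, GEN-38).  NEW WORK of the cell,
general state space with `MeasurableEq Ω`; sequel to this generation's `…MergedForever` (merged runs stay merged, a.s.),
`…MeetingTimeLaw` (geometric tail) and `…MeetingTimeSharp` (exact laws from (cold, off-mode)) for the disagreement time
`T_M = #{n < M : X_n ≠ X′_n}` (here ℕ-valued: `Σ_{n<M} 1{z_n ∉ Δ}` with the ℕ-valued indicator) of the CRN pair chain of
`K = indepMH q w` (`W = w(x₀)`, `r = 1 − 1/W`).  The moment generating function: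

* §1 **`pow_disagreementCount_eq`** — pathwise, when merged runs stay merged along `z`: `s^{T_M} = 1 + (s − 1)·Σ_{n<M} sⁿ·1{z_n ∉ Δ}`
  for every real `s` (the disagreement set is an initial segment; `(s − 1)Σ_{n<T} sⁿ = s^T − 1`) [bookkeeping].
* §2 **`crn_chain_integral_pow_disagreementCount_eq`** — `E[s^{T_M}] = 1 + (s − 1)·Σ_{n<M} sⁿ·P(X_n ≠ X′_n)` EXACTLY from every
  initial coupling; **`crn_chain_integral_pow_disagreementCount_le`** — for `s ≥ 1`: `≤ 1 + (s − 1)·P(X_0 ≠ X′_0)·Σ_{n<M}(s r)ⁿ`;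
  **`crn_chain_integral_pow_disagreementCount_le_of_lt`** — for `1 ≤ s` and `s·r < 1`: `≤ 1 + (s − 1)·P(X_0 ≠ X′_0)/(1 − s r)`
  UNIFORMLY IN `M` — every exponential moment of order `< log(1/r) = log(1/(1 − A))` is finite, with an explicit bound.
* §3 **`crn_chain_integral_pow_disagreementCount_eq_cold`** — from (cold, off-mode) with an atom-free proposal:
  `E[s^{T_M}] = 1 + (s − 1)·Σ_{n<M}(s r)ⁿ` EXACTLY (the generating function of the geometric law truncated at `M`).
Reading (gauge files): the random overhead of the coupled estimators of two exact gauge samplers on one stream of random numbers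
has exponential moments `E[s^T] ≤ 1 + (s − 1)/(1 − s(1 − A))` for every `s < 1/(1 − A)` (times the initial disagreement
probability in the excess over `1`).
NOT CLAIMED: the `M = ∞` statement (it follows by monotone convergence; not typed); two different proposals; any value of `A`.
No `sorry`, no new definitions, nothing cited as a fact.
-/

noncomputable section

namespace Summit.Ventures.LatticeQCDFlow.Exactness

open MeasureTheory ProbabilityTheory Function Finset Filter
open scoped ENNReal unitInterval Topology
open Summit.Ventures.LatticeQCDFlow.Scoring

variable {Ω : Type*} [MeasurableSpace Ω] {q : Measure Ω} [IsProbabilityMeasure q] {w : Ω → ℝ}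

/-! ## §1 Pathwise: `s^{T_M} = 1 + (s − 1)·Σ_{n<M} sⁿ·1{z_n ∉ Δ}` along a path where merged runs stay merged -/

omit [MeasurableSpace Ω] in
/-- Pathwise: if merged runs stay merged along `z`, then for every real `s` and every `M`,
`s ^ (Σ_{n<M} 1{z_n ∉ Δ}) = 1 + (s − 1)·Σ_{n<M} sⁿ·1{z_n ∉ Δ}`. [ours, bookkeeping] -/
theorem pow_disagreementCount_eq {z : ℕ → Ω × Ω}
    (hz : ∀ n m, n ≤ m → z n ∈ Set.diagonal Ω → z m ∈ Set.diagonal Ω) (s : ℝ) :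
    ∀ M : ℕ, s ^ (∑ n ∈ Finset.range M, ((Set.diagonal Ω)ᶜ).indicator (1 : Ω × Ω → ℕ) (z n)) =
      1 + (s - 1) * ∑ n ∈ Finset.range M, s ^ n * ((Set.diagonal Ω)ᶜ).indicator (1 : Ω × Ω → ℝ) (z n)
  | 0 => by simp
  | M + 1 => by
    by_cases hM : z M ∈ Set.diagonal Ω
    · have h0 : ((Set.diagonal Ω)ᶜ).indicator (1 : Ω × Ω → ℕ) (z M) = 0 :=
        Set.indicator_of_notMem (show z M ∉ (Set.diagonal Ω)ᶜ from fun h => h hM) _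
      have h0' : ((Set.diagonal Ω)ᶜ).indicator (1 : Ω × Ω → ℝ) (z M) = 0 :=
        Set.indicator_of_notMem (show z M ∉ (Set.diagonal Ω)ᶜ from fun h => h hM) _
      rw [Finset.sum_range_succ, Finset.sum_range_succ, h0, h0', add_zero, mul_zero, add_zero]
      exact pow_disagreementCount_eq hz s M
    · -- every earlier time is off the diagonal: the count is `M + 1` and the weighted sum is the full geometric sum
      have hall : ∀ n, n ≤ M → z n ∉ Set.diagonal Ω := fun n hn h => hM (hz n M hn h)
      have hN : ∀ n ∈ Finset.range (M + 1), ((Set.diagonal Ω)ᶜ).indicator (1 : Ω × Ω → ℕ) (z n) = 1 := fun n hn => by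
        rw [Set.indicator_of_mem (show z n ∈ (Set.diagonal Ω)ᶜ from hall n (Nat.lt_succ_iff.1 (Finset.mem_range.1 hn))),
          Pi.one_apply]
      have hR : ∀ n ∈ Finset.range (M + 1), s ^ n * ((Set.diagonal Ω)ᶜ).indicator (1 : Ω × Ω → ℝ) (z n) = s ^ n := fun n hn => by
        rw [Set.indicator_of_mem (show z n ∈ (Set.diagonal Ω)ᶜ from hall n (Nat.lt_succ_iff.1 (Finset.mem_range.1 hn))),
          Pi.one_apply, mul_one]
      rw [Finset.sum_congr rfl hN, Finset.sum_congr rfl hR, sum_const, card_range, smul_eq_mul, mul_one]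
      have h := geom_sum_mul s (M + 1)
      linarith

/-! ## §2 The moment generating function of the disagreement time -/

/-- **`E[s^{T_M}] = 1 + (s − 1)·Σ_{n<M} sⁿ·P(X_n ≠ X′_n)` EXACTLY** on the pair path law from every initial coupling (`MeasurableEq Ω`),
for every real `s`. [ours] -/
theorem crn_chain_integral_pow_disagreementCount_eq [MeasurableEq Ω] (hw : Measurable w) (hw0 : ∀ y, 0 < w y)
    (Khat : Kernel (Ω × Ω) (Ω × Ω)) [IsMarkovKernel Khat]
    (hK : ∀ z : Ω × Ω, Khat z = (q.prod (volume : Measure unitInterval)).map (fun p : Ω × unitInterval =>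
      ((if (p.2 : ℝ) * w z.1 ≤ w p.1 then p.1 else z.1), (if (p.2 : ℝ) * w z.2 ≤ w p.1 then p.1 else z.2))))
    (μ₀ : Measure (Ω × Ω)) [IsProbabilityMeasure μ₀] (s : ℝ) (M : ℕ) :
    ∫ z, s ^ (∑ n ∈ Finset.range M, ((Set.diagonal Ω)ᶜ).indicator (1 : Ω × Ω → ℕ) (z n))
        ∂(Kernel.trajMeasure (X := fun _ : ℕ => Ω × Ω) μ₀
          (fun n : ℕ => Khat.comap (fun h : (i : ↥(Finset.Iic n)) → Ω × Ω => h ⟨n, Finset.mem_Iic.2 le_rfl⟩)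
            (measurable_pi_apply _))) =
      1 + (s - 1) * ∑ n ∈ Finset.range M, s ^ n * ((fun m : Measure (Ω × Ω) => m.bind Khat)^[n] μ₀).real (Set.diagonal Ω)ᶜ := by
  set P := Kernel.trajMeasure (X := fun _ : ℕ => Ω × Ω) μ₀
      (fun n : ℕ => Khat.comap (fun h : (i : ↥(Finset.Iic n)) → Ω × Ω => h ⟨n, Finset.mem_Iic.2 le_rfl⟩)
        (measurable_pi_apply _)) with hP
  have hD : MeasurableSet (Set.diagonal Ω) := measurableSet_diagonal
  have hIm : Measurable ((Set.diagonal Ω)ᶜ.indicator (1 : Ω × Ω → ℝ)) := measurable_one.indicator hD.compl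
  have hIb : ∀ p : Ω × Ω, |(Set.diagonal Ω)ᶜ.indicator (1 : Ω × Ω → ℝ) p| ≤ 1 := by
    intro p
    by_cases hp : p ∈ (Set.diagonal Ω)ᶜ
    · rw [Set.indicator_of_mem hp, Pi.one_apply, abs_one]
    · rw [Set.indicator_of_notMem hp, abs_zero]; exact zero_le_one
  have hIi : ∀ n, Integrable (fun z : ℕ → Ω × Ω => (Set.diagonal Ω)ᶜ.indicator (1 : Ω × Ω → ℝ) (z n)) P := fun n =>
    integrable_of_bounded P (hIm.comp (measurable_pi_apply n)) (fun z => hIb _)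
  have hae : (fun z : ℕ → Ω × Ω => s ^ (∑ n ∈ Finset.range M, ((Set.diagonal Ω)ᶜ).indicator (1 : Ω × Ω → ℕ) (z n))) =ᵐ[P]
      fun z => 1 + (s - 1) * ∑ n ∈ Finset.range M, s ^ n * ((Set.diagonal Ω)ᶜ).indicator (1 : Ω × Ω → ℝ) (z n) := by
    filter_upwards [crn_chain_ae_merged_stay hw hw0 Khat hK μ₀] with z hz
    exact pow_disagreementCount_eq hz s M
  have hSi : Integrable (fun z : ℕ → Ω × Ω =>
      ∑ n ∈ Finset.range M, s ^ n * ((Set.diagonal Ω)ᶜ).indicator (1 : Ω × Ω → ℝ) (z n)) P :=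
    integrable_finsetSum _ fun n _ => (hIi n).const_mul _
  rw [integral_congr_ae hae, integral_add (integrable_const _) (hSi.const_mul _), integral_const, probReal_univ, one_smul,
    integral_const_mul, integral_finsetSum _ fun n _ => (hIi n).const_mul _]
  congr 2
  refine sum_congr rfl fun n _ => ?_
  rw [integral_const_mul, hP, chain_expect_eq_integral_iterate_bind Khat μ₀ hIm hIb n, integral_indicator_one hD.compl]

/-- **`E[s^{T_M}] ≤ 1 + (s − 1)·P(X_0 ≠ X′_0)·Σ_{n<M}(s r)ⁿ`** for `s ≥ 1`, from every initial coupling (`w` normalised, maximal at `x₀`,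
`r = 1 − 1/w(x₀)`). [ours] -/
theorem crn_chain_integral_pow_disagreementCount_le [MeasurableEq Ω] (hw : Measurable w) (hw0 : ∀ y, 0 < w y) {x₀ : Ω}
    (hmax : ∀ y, w y ≤ w x₀) [IsProbabilityMeasure (q.withDensity fun y => ENNReal.ofReal (w y))]
    (Khat : Kernel (Ω × Ω) (Ω × Ω)) [IsMarkovKernel Khat]
    (hK : ∀ z : Ω × Ω, Khat z = (q.prod (volume : Measure unitInterval)).map (fun p : Ω × unitInterval =>
      ((if (p.2 : ℝ) * w z.1 ≤ w p.1 then p.1 else z.1), (if (p.2 : ℝ) * w z.2 ≤ w p.1 then p.1 else z.2))))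
    (μ₀ : Measure (Ω × Ω)) [IsProbabilityMeasure μ₀] {s : ℝ} (hs : 1 ≤ s) (M : ℕ) :
    ∫ z, s ^ (∑ n ∈ Finset.range M, ((Set.diagonal Ω)ᶜ).indicator (1 : Ω × Ω → ℕ) (z n))
        ∂(Kernel.trajMeasure (X := fun _ : ℕ => Ω × Ω) μ₀
          (fun n : ℕ => Khat.comap (fun h : (i : ↥(Finset.Iic n)) → Ω × Ω => h ⟨n, Finset.mem_Iic.2 le_rfl⟩)
            (measurable_pi_apply _))) ≤
      1 + (s - 1) * (μ₀.real (Set.diagonal Ω)ᶜ * ∑ n ∈ Finset.range M, (s * (1 - (w x₀)⁻¹)) ^ n) := by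
  rw [crn_chain_integral_pow_disagreementCount_eq hw hw0 Khat hK μ₀ s M]
  have hs0 : 0 ≤ s := zero_le_one.trans hs
  have hsum : ∑ n ∈ Finset.range M, s ^ n * ((fun m : Measure (Ω × Ω) => m.bind Khat)^[n] μ₀).real (Set.diagonal Ω)ᶜ ≤
      μ₀.real (Set.diagonal Ω)ᶜ * ∑ n ∈ Finset.range M, (s * (1 - (w x₀)⁻¹)) ^ n := by
    rw [mul_sum]
    refine sum_le_sum fun n _ => ?_
    calc s ^ n * ((fun m : Measure (Ω × Ω) => m.bind Khat)^[n] μ₀).real (Set.diagonal Ω)ᶜ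
        ≤ s ^ n * ((1 - (w x₀)⁻¹) ^ n * μ₀.real (Set.diagonal Ω)ᶜ) :=
          mul_le_mul_of_nonneg_left (iterate_bind_crnPair_offDiagonal_le hw hw0 hmax Khat hK n μ₀) (pow_nonneg hs0 n)
      _ = μ₀.real (Set.diagonal Ω)ᶜ * (s * (1 - (w x₀)⁻¹)) ^ n := by rw [mul_pow]; ring
  have hs1 : 0 ≤ s - 1 := sub_nonneg.2 hs
  nlinarith

/-- **ALL EXPONENTIAL MOMENTS BELOW THE RATE `log(1/r)`**: for `1 ≤ s` and `s·r < 1`,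
`E[s^{T_M}] ≤ 1 + (s − 1)·P(X_0 ≠ X′_0)/(1 − s r)` uniformly in `M`. [ours] -/
theorem crn_chain_integral_pow_disagreementCount_le_of_lt [MeasurableEq Ω] (hw : Measurable w) (hw0 : ∀ y, 0 < w y) {x₀ : Ω}
    (hmax : ∀ y, w y ≤ w x₀) [IsProbabilityMeasure (q.withDensity fun y => ENNReal.ofReal (w y))]
    (Khat : Kernel (Ω × Ω) (Ω × Ω)) [IsMarkovKernel Khat]
    (hK : ∀ z : Ω × Ω, Khat z = (q.prod (volume : Measure unitInterval)).map (fun p : Ω × unitInterval =>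
      ((if (p.2 : ℝ) * w z.1 ≤ w p.1 then p.1 else z.1), (if (p.2 : ℝ) * w z.2 ≤ w p.1 then p.1 else z.2))))
    (μ₀ : Measure (Ω × Ω)) [IsProbabilityMeasure μ₀] {s : ℝ} (hs : 1 ≤ s) (hsr : s * (1 - (w x₀)⁻¹) < 1) (M : ℕ) :
    ∫ z, s ^ (∑ n ∈ Finset.range M, ((Set.diagonal Ω)ᶜ).indicator (1 : Ω × Ω → ℕ) (z n))
        ∂(Kernel.trajMeasure (X := fun _ : ℕ => Ω × Ω) μ₀
          (fun n : ℕ => Khat.comap (fun h : (i : ↥(Finset.Iic n)) → Ω × Ω => h ⟨n, Finset.mem_Iic.2 le_rfl⟩)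
            (measurable_pi_apply _))) ≤
      1 + (s - 1) * (μ₀.real (Set.diagonal Ω)ᶜ / (1 - s * (1 - (w x₀)⁻¹))) := by
  have hW : 1 ≤ w x₀ := one_le_of_mode (q := q) hmax
  have hr0 : 0 ≤ 1 - (w x₀)⁻¹ := sub_nonneg.2 (inv_le_one_of_one_le₀ hW)
  have hs0 : 0 ≤ s := zero_le_one.trans hs
  have hsr0 : 0 ≤ s * (1 - (w x₀)⁻¹) := mul_nonneg hs0 hr0
  refine (crn_chain_integral_pow_disagreementCount_le hw hw0 hmax Khat hK μ₀ hs M).trans ?_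
  have hgeo : ∑ n ∈ Finset.range M, (s * (1 - (w x₀)⁻¹)) ^ n ≤ (1 - s * (1 - (w x₀)⁻¹))⁻¹ :=
    (sum_le_hasSum (range M) (fun n _ => pow_nonneg hsr0 n) (hasSum_geometric_of_lt_one hsr0 hsr))
  have hs1 : 0 ≤ s - 1 := sub_nonneg.2 hs
  rw [div_eq_mul_inv]
  have h := mul_le_mul_of_nonneg_left (mul_le_mul_of_nonneg_left hgeo (measureReal_nonneg (μ := μ₀) (s := (Set.diagonal Ω)ᶜ))) hs1
  linarith

/-! ## §3 From (cold, off-mode): the generating function of the geometric law, exactly -/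

/-- **`E[s^{T_M}] = 1 + (s − 1)·Σ_{n<M}(s r)ⁿ` EXACTLY** from the coupling (first run at the mode, second run never at the mode),
atom-free proposal (`q{x₀} = 0`). [ours] -/
theorem crn_chain_integral_pow_disagreementCount_eq_cold [MeasurableSingletonClass Ω] [MeasurableEq Ω] (hw : Measurable w)
    (hw0 : ∀ y, 0 < w y) {x₀ : Ω} (hmax : ∀ y, w y ≤ w x₀) [IsProbabilityMeasure (q.withDensity fun y => ENNReal.ofReal (w y))]
    (hq0 : q {x₀} = 0) (Khat : Kernel (Ω × Ω) (Ω × Ω)) [IsMarkovKernel Khat]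
    (hK : ∀ z : Ω × Ω, Khat z = (q.prod (volume : Measure unitInterval)).map (fun p : Ω × unitInterval =>
      ((if (p.2 : ℝ) * w z.1 ≤ w p.1 then p.1 else z.1), (if (p.2 : ℝ) * w z.2 ≤ w p.1 then p.1 else z.2))))
    (μ₀ : Measure (Ω × Ω)) [IsProbabilityMeasure μ₀] (hfst : μ₀.map Prod.fst = Measure.dirac x₀)
    (hsnd : (μ₀.map Prod.snd) {x₀} = 0) (s : ℝ) (M : ℕ) :
    ∫ z, s ^ (∑ n ∈ Finset.range M, ((Set.diagonal Ω)ᶜ).indicator (1 : Ω × Ω → ℕ) (z n))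
        ∂(Kernel.trajMeasure (X := fun _ : ℕ => Ω × Ω) μ₀
          (fun n : ℕ => Khat.comap (fun h : (i : ↥(Finset.Iic n)) → Ω × Ω => h ⟨n, Finset.mem_Iic.2 le_rfl⟩)
            (measurable_pi_apply _))) =
      1 + (s - 1) * ∑ n ∈ Finset.range M, (s * (1 - (w x₀)⁻¹)) ^ n := by
  rw [crn_chain_integral_pow_disagreementCount_eq hw hw0 Khat hK μ₀ s M]
  congr 2
  exact sum_congr rfl fun n _ => by
    rw [iterate_bind_crnPair_offDiagonal_eq hw hw0 hmax hq0 Khat hK n μ₀ hfst hsnd, mul_pow]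

end Summit.Ventures.LatticeQCDFlow.Exactness

end
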